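import Summits.BirchSwinnertonDyer.Rank1Residual.Additive.X4TwistLevelLoweringCertificate
import Summits.BirchSwinnertonDyer.Rank1Residual.Additive.X4TwistLevelLoweringCertificateOdd
import HarnessLib

/-!
# The twist certificate from CURVE-FREE `V`-side data: one Hecke hypothesis read on `W`, no `a_q(W) ≡ (q/p)a_q(V)` binder (cell `b2b-bsdres`, seat additive-p4, line V40; corollaries of `X4TwistLevelLoweringCertificate{,Odd}`)

HONEST FRAMING (verbatim, cell `b2b-bsdres`): the goal of the cell is to DELETE the COMBINATION-SHAPED
residual classes for ALL analytic-rank `≤ 1` curves over `ℚ` — "full BSD formula for every rank `≤ 1`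
curve in class `C`" assembled STRICTLY from published theorems — so that the rank-`≤ 1` remainder
becomes exactly the CONSTRUCTION-SHAPED classes, which are TYPED (missing-input Props), NOT attempted;
this is not "finishing BSD". Theorems only; nothing booked; class X4 stays CONSTRUCTION-SHAPED; the
`V`-side certificate is a per-pair instrument output (EVIDENCE), never a fact.

## What is proved

The transports of `X4/KuriharaLevelLoweringTwist{,Minus}` and the assemblies
`plusSymbolLevelLowersAt_of_twist_certificate[_minus]` ask for the `V`-side function `μ` to be
`T_q`-eigen with eigenvalue `a_q(V)` at the Kolyvagin primes `q` of `(W, p)` AND for the twist relation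
`a_q(W) ≡ (q/p)·a_q(V)`. Since `(q/p)² = 1` the two merge into ONE hypothesis that mentions no curve
`V` at all: `μ` is `T_q`-eigen with eigenvalue `(q/p)·a_q(W)`. This file proves the transport in that
CURVE-FREE form — the `V`-side symbol enters only as a `p`-integral function `Φ : ℚ → ℚ` (the plus
symbol of `f_V` at `p ≡ 1 mod 4`, the minus symbol at `p ≡ 3 mod 4`):
* §1 `plusSymbolLevelLowersAt_of_legendreTwistFn`: `[r]⁺_{f_W} = c₀·∑_u (u/p)Φ(r + u/p)` (`c₀`, `Φ`
  `p`-integral), `Φ ≡ μ − w μ∘[ℓ] (mod p)`, `μ` periodic and `T_q`-eigen with `(q/p)a_q(W)` at the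
  Kolyvagin primes, `p ∤ ℓ`, `w·(ℓ/p) = 1` ⟹ `PlusSymbolLevelLowersAt W p f_W ℓ`;
* §2 `plusSymbolLevelLowersAt_of_twist_certificate_eigen` (`p ≡ 1 mod 4`, `Φ = [·]⁺_{f_V}`, period
  bookkeeping by `X4TwistLevelLoweringCertificate` §2–§3, named fact `hPal`) and
  `plusSymbolLevelLowersAt_of_twist_certificate_minus_eigen` (`p ≡ 3 mod 4`, `Φ = [·]⁻_{f_V}`, fact-free
  bookkeeping by `X4TwistLevelLoweringCertificateOdd` §2–§3): the assembled theorems with the merged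
  hypothesis.

References: [cite: Kim2022StructureSelmer, §1.2.2 and §1.4.3]; [cite: MazurTateTeitelbaum1986Invent, §I.4 (4.2) and §I.8];
[cite: Pal2012, Thm. 3.2].
-/

noncomputable section

open scoped Classical MatrixGroups ModularForm

open CongruenceSubgroup WeierstrassCurve Literature.NumberTheory.EllipticCurves
  Literature.NumberTheory.EllipticCurves.ModularForms
  Literature.NumberTheory.EllipticCurves.Rank1Residual
  Literature.NumberTheory.QuadraticFields
  Summit.BirchSwinnertonDyer.Rank1Residual.LevelLowering

namespace Summit.BirchSwinnertonDyer.Rank1Residual.Additive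

variable {p : ℕ} [hp : Fact p.Prime]

/-! ### §1 The curve-free transport -/

/-- Casting a `p`-integral product of rationals to `ℤ/p`. [folklore] -/
private theorem ratCast_mul_of_not_dvd'' {a b : ℚ} (ha : ¬ p ∣ a.den) (hb : ¬ p ∣ b.den) :
    ((a * b : ℚ) : ZMod p) = (a : ZMod p) * (b : ZMod p) :=
  Rat.cast_mul_of_ne_zero (mt (ZMod.natCast_eq_zero_iff _ _).mp ha)
    (mt (ZMod.natCast_eq_zero_iff _ _).mp hb)

/-- A sum of `p`-integral rationals is `p`-integral and casts termwise to `ℤ/p`. [folklore] -/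
private theorem ratCast_sum_of_not_dvd'' {ι : Type*} (s : Finset ι) (g : ι → ℚ)
    (h : ∀ i ∈ s, ¬ p ∣ (g i).den) :
    ¬ p ∣ (∑ i ∈ s, g i).den ∧ ((∑ i ∈ s, g i : ℚ) : ZMod p) = ∑ i ∈ s, ((g i : ℚ) : ZMod p) := by
  classical
  induction s using Finset.induction_on with
  | empty => simp [hp.out.one_lt.ne']
  | insert a s has ih =>
    have ha : ¬ p ∣ (g a).den := h a (Finset.mem_insert_self a s)
    obtain ⟨hs, hcast⟩ := ih fun i hi ↦ h i (Finset.mem_insert_of_mem hi)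
    rw [Finset.sum_insert has, Finset.sum_insert has]
    refine ⟨fun hd ↦ ?_, ?_⟩
    · have := hd.trans (Rat.add_den_dvd (g a) (∑ i ∈ s, g i))
      rcases (Nat.Prime.dvd_mul hp.out).mp this with h1 | h1
      · exact ha h1
      · exact hs h1
    · rw [Rat.cast_add_of_ne_zero (mt (ZMod.natCast_eq_zero_iff _ _).mp ha)
        (mt (ZMod.natCast_eq_zero_iff _ _).mp hs), hcast]

/-- The Legendre symbol mod `p` in `ℤ/p` as a monoid hom, evaluated. [folklore] -/
private theorem legendreHom_apply'' (u : ZMod p) :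
    ((quadraticChar (ZMod p)).ringHomComp (Int.castRingHom (ZMod p))).toMonoidHom u =
      ((legendreSym p (u.val : ℤ) : ℤ) : ZMod p) := by
  rw [MulChar.coe_toMonoidHom, MulChar.ringHomComp_apply, legendreSym, Int.cast_natCast,
    ZMod.natCast_zmod_val]
  rfl

/-- `((n/p))² = 1` in `ℤ/p` for `p ∤ n`. [folklore] -/
private theorem legendreHom_sq_eq_one'' {n : ℕ} (hn : ¬ p ∣ n) :
    ((quadraticChar (ZMod p)).ringHomComp (Int.castRingHom (ZMod p))).toMonoidHom (n : ZMod p) ^ 2 = 1 := by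
  have hn0 : (n : ZMod p) ≠ 0 := mt (ZMod.natCast_eq_zero_iff _ _).mp hn
  rw [MulChar.coe_toMonoidHom, MulChar.ringHomComp_apply, ← map_pow, quadraticChar_sq_one hn0]
  simp

/-- **CURVE-FREE TRANSPORT.** `W` globally minimal, `f_W` a cusp form whose plus symbol is the
Legendre-twisted sum of a `p`-integral function `Φ : ℚ → ℚ` with one `p`-integral constant,
`[r]⁺_{f_W} = c₀ · ∑_{u mod p} (u/p) Φ(r + u/p)`; `Φ ≡ μ − w·μ∘[ℓ] (mod p)` with `μ` periodic and
`T_q`-eigen with eigenvalue `(q/p)·a_q(W)` at every Kolyvagin prime `q` of `(W, p)`; `p ∤ ℓ`,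
`w·(ℓ/p) = 1`. Then `PlusSymbolLevelLowersAt W p f_W ℓ`. (`Φ` = the plus or minus symbol of the newform
of the semistable twist `V`; no hypothesis mentions `V`.) [cite: Kim2022StructureSelmer, §1.2.2 and §1.4.3]
[cite: MazurTateTeitelbaum1986Invent, §I.4 (4.2) and §I.8] -/
theorem plusSymbolLevelLowersAt_of_legendreTwistFn (W : WeierstrassCurve ℚ) [W.IsGloballyMinimal]
    {NW : ℕ} (fW : CuspForm (Gamma0 NW) 2) (Φ : ℚ → ℚ) (c₀ : ℚ) (hc : ¬ p ∣ c₀.den)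
    (hint : ∀ x : ℚ, ¬ p ∣ (Φ x).den)
    (hsym : ∀ r : ℚ, ratPlusSymbol fW r =
      c₀ * ∑ u : ZMod p, (legendreSym p (u.val : ℤ) : ℚ) * Φ (r + (u.val : ℚ) / p))
    {μ : ℚ → ZMod p} (hμ : IsPeriodic μ) {w : ZMod p} {ℓ : ℕ} (hℓ : ¬ p ∣ ℓ)
    (hV : ∀ r : ℚ, ((Φ r : ℚ) : ZMod p) = μ r - w * μ (ℓ * r))
    (hw : w * ((legendreSym p (ℓ : ℤ) : ℤ) : ZMod p) = 1)
    (hH : ∀ q : ℕ, Kato.IsKolyvaginPrime W p 1 q →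
      HeckeRel μ q (((legendreSym p (q : ℤ) : ℤ) : ZMod p) * (W.frobeniusTrace q : ZMod p))) :
    PlusSymbolLevelLowersAt W p fW ℓ := by
  haveI : NeZero p := ⟨hp.out.ne_zero⟩
  set χ : ZMod p →* ZMod p :=
    ((quadraticChar (ZMod p)).ringHomComp (Int.castRingHom (ZMod p))).toMonoidHom with hχdef
  have hχnat : ∀ n : ℕ, χ (n : ZMod p) = ((legendreSym p (n : ℤ) : ℤ) : ZMod p) := by
    intro n
    rw [hχdef, legendreHom_apply'', ZMod.val_natCast, Int.natCast_mod, ← legendreSym.mod]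
  set φ : ℚ → ZMod p := fun x ↦ ((Φ x : ℚ) : ZMod p) with hφdef
  have hsymP : ∀ r : ℚ, ((ratPlusSymbol fW r : ℚ) : ZMod p) =
      (c₀ : ZMod p) * ∑ u : ZMod p, χ u * φ (r + (u.val : ℚ) / p) := by
    intro r
    have hterm : ∀ u ∈ (Finset.univ : Finset (ZMod p)),
        ¬ p ∣ ((legendreSym p (u.val : ℤ) : ℚ) * Φ (r + (u.val : ℚ) / p)).den := by
      intro u _ hd
      have := hd.trans (Rat.mul_den_dvd _ _)
      rw [Rat.den_intCast, one_mul] at this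
      exact hint _ this
    obtain ⟨hden, hcast⟩ := ratCast_sum_of_not_dvd'' (p := p) Finset.univ _ hterm
    rw [hsym r, ratCast_mul_of_not_dvd'' hc hden, hcast]
    congr 1
    refine Finset.sum_congr rfl fun u _ ↦ ?_
    rw [ratCast_mul_of_not_dvd'' (by rw [Rat.den_intCast]; exact hp.out.one_lt.ne' ∘ Nat.dvd_one.mp)
      (hint _), Rat.cast_intCast, hχdef, legendreHom_apply'']
  have hℓu : IsUnit ((ℓ : ℕ) : ZMod p) :=
    (ZMod.isUnit_iff_coprime ℓ p).mpr ((Nat.coprime_comm).mp ((Nat.Prime.coprime_iff_not_dvd hp.out).mpr hℓ))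
  have hχℓ : χ ℓ ^ 2 = 1 := legendreHom_sq_eq_one'' hℓ
  have hw' : w * χ ℓ = 1 := by rwa [hχnat ℓ]
  refine plusSymbolLevelLowersAt_of_twistSum_fn W p χ fW (c₀ : ZMod p) φ hsymP hμ hV hℓu hχℓ hw'
    (fun q ↦ χ q * (W.frobeniusTrace q : ZMod p)) fun q hq ↦ ?_
  have hqp : ¬ p ∣ q := fun hd ↦
    hq.ne ((Nat.prime_dvd_prime_iff_eq hp.out hq.prime).mp hd).symm
  have hqu : IsUnit ((q : ℕ) : ZMod p) :=
    (ZMod.isUnit_iff_coprime q p).mpr ((Nat.coprime_comm).mp ((Nat.Prime.coprime_iff_not_dvd hp.out).mpr hqp))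
  have hχq : χ q ^ 2 = 1 := legendreHom_sq_eq_one'' hqp
  refine ⟨?_, hqu, hχq, ?_⟩
  · rw [hχnat q]; exact hH q hq
  · rw [← mul_assoc, ← sq, hχq, one_mul]

/-! ### §2 The assembled certificates with the merged Hecke hypothesis -/

variable (p)

/-- **`p ≡ 1 (mod 4)`: the certificate of `W = V ⊗ χ_p` from the `V`-side PLUS-symbol certificate
data with the Hecke eigenvalues read on `W`** (no `a_q` twist binder): as
`plusSymbolLevelLowersAt_of_twist_certificate`, but `μ` `T_q`-eigen with `(q/p)·a_q(W)`.
[cite: Pal2012, Thm. 3.2] [cite: Kim2022StructureSelmer, §1.2.2 and §1.4.3] -/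
theorem plusSymbolLevelLowersAt_of_twist_certificate_eigen
    (hPal : Pal2012.thm32_sqrt_mul_realPeriodRat_twist_eq_of_prime_one_mod_four) (hp4 : p % 4 = 1)
    (V W : WeierstrassCurve ℚ) [V.IsElliptic] [V.IsGloballyMinimal] [W.IsElliptic] [W.IsGloballyMinimal]
    (hVW : ∃ C : VariableChange ℚ, C • V.quadraticTwist (p : ℚ) = W) (hVred : Good V p ∨ Mult V p)
    (hadd : Addv W p) {NV NW : ℕ} [NeZero NV] [NeZero NW] {fV : CuspForm (Gamma0 NV) 2}
    {fW : CuspForm (Gamma0 NW) 2} (hfV : IsNewformOf V fV) (hfW : IsNewformOf W fW) (hN : NV ∣ NW)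
    (hm : p ^ 2 ∣ NW)
    (hperW : ∃ u : ℚ, ‖(u : ℚ_[p])‖ = 1 ∧ W.realPeriodRat = u * plusPeriod fW)
    (hperV : ∃ u : ℚ, ‖(u : ℚ_[p])‖ = 1 ∧ V.realPeriodRat = u * plusPeriod fV)
    (hint : ∀ x : ℚ, ¬ p ∣ (ratPlusSymbol fV x).den)
    {μ : ℚ → ZMod p} (hμ : IsPeriodic μ) {w : ZMod p} {ℓ : ℕ} (hℓ : ¬ p ∣ ℓ)
    (hV : ∀ r : ℚ, ((ratPlusSymbol fV r : ℚ) : ZMod p) = μ r - w * μ (ℓ * r))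
    (hw : w * ((legendreSym p (ℓ : ℤ) : ℤ) : ZMod p) = 1)
    (hH : ∀ q : ℕ, Kato.IsKolyvaginPrime W p 1 q →
      HeckeRel μ q (((legendreSym p (q : ℤ) : ℤ) : ZMod p) * (W.frobeniusTrace q : ZMod p))) :
    PlusSymbolLevelLowersAt W p fW ℓ := by
  haveI : NeZero p := ⟨hp.out.ne_zero⟩
  obtain ⟨c₀, hc₀, hrel⟩ := exists_rat_ratPlusSymbol_eq_legendreTwistSum p hp4 V W hVW hadd hfV hfW hN hm
  by_cases hex : ∃ r : ℚ,
      ∑ u : ZMod p, (legendreSym p (u.val : ℤ) : ℚ) * ratPlusSymbol fV (r + (u.val : ℚ) / p) ≠ 0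
  · obtain ⟨hχ1, hχq, _⟩ := jacobiChar_prime_ne_one_isQuadratic_isPrimitive p (show p ≠ 2 by omega)
    have hχe := jacobiChar_even_of_mod_four_eq_one p hp4
    have hτ : gaussSum (jacobiChar p) (ZMod.stdAddChar (N := p)) ^ 2 = (p : ℂ) := by
      rw [gaussSum_sq hχ1 hχq (ZMod.isPrimitive_stdAddChar p), hχe, one_mul, ZMod.card]
    obtain ⟨uW, huW, hΩW⟩ := hperW
    obtain ⟨uV, huV, hΩV⟩ := hperV
    have hunit : ‖(c₀ : ℚ_[p])‖ = 1 :=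
      norm_ratCast_eq_one_of_period_relation p hτ (hrel hex) (hPal V W p hp4 hVred hVW) hΩW hΩV huW huV
        W.realPeriodRat_pos_holds
    exact plusSymbolLevelLowersAt_of_legendreTwistFn W fW (fun x ↦ ratPlusSymbol fV x) c₀
      (not_dvd_den_of_norm_ratCast_le_one hunit.le) hint hc₀ hμ hℓ hV hw hH
  · simp only [not_exists, not_not] at hex
    refine ⟨0, fun _ _ ↦ rfl, fun q _ r ↦ by simp, fun r ↦ ?_⟩
    rw [hc₀ r, hex r, mul_zero, Rat.cast_zero, Pi.zero_apply, Pi.zero_apply, sub_zero]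

/-- **`p ≡ 3 (mod 4)` (the `p = 3` block): the certificate of `W = V ⊗ χ_{−p}` from the `V`-side
MINUS-symbol certificate data with the Hecke eigenvalues read on `W`**, NO named fact: as
`plusSymbolLevelLowersAt_of_twist_certificate_minus`, but `μ` `T_q`-eigen with `(q/p)·a_q(W)`.
[cite: Pal2012, Thm. 3.2 and Prop. 2.5] [cite: Kim2022StructureSelmer, §1.2.2 and §1.4.3] -/
theorem plusSymbolLevelLowersAt_of_twist_certificate_minus_eigen (hp4 : p % 4 = 3)
    (V W : WeierstrassCurve ℚ) [V.IsElliptic] [V.IsGloballyMinimal] [W.IsElliptic] [W.IsGloballyMinimal]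
    (C : VariableChange ℚ) (hC : C • V.quadraticTwist (-(p : ℚ)) = W) (hVred : Good V p ∨ Mult V p)
    (hadd : Addv W p) {NV NW : ℕ} [NeZero NV] [NeZero NW] {fV : CuspForm (Gamma0 NV) 2}
    {fW : CuspForm (Gamma0 NW) 2} (hfV : IsNewformOf V fV) (hfW : IsNewformOf W fW) (hN : NV ∣ NW)
    (hm : p ^ 2 ∣ NW)
    (hperW : ∃ u : ℚ, ‖(u : ℚ_[p])‖ = 1 ∧ W.realPeriodRat = u * plusPeriod fW)
    (hperV : ∃ u : ℚ, ‖(u : ℚ_[p])‖ = 1 ∧ V.imaginaryPeriodRat = u * minusPeriod fV)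
    (hint : ∀ x : ℚ, ¬ p ∣ (ratMinusSymbol fV x).den)
    {μ : ℚ → ZMod p} (hμ : IsPeriodic μ) {w : ZMod p} {ℓ : ℕ} (hℓ : ¬ p ∣ ℓ)
    (hV : ∀ r : ℚ, ((ratMinusSymbol fV r : ℚ) : ZMod p) = μ r - w * μ (ℓ * r))
    (hw : w * ((legendreSym p (ℓ : ℤ) : ℤ) : ZMod p) = 1)
    (hH : ∀ q : ℕ, Kato.IsKolyvaginPrime W p 1 q →
      HeckeRel μ q (((legendreSym p (q : ℤ) : ℤ) : ZMod p) * (W.frobeniusTrace q : ZMod p))) :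
    PlusSymbolLevelLowersAt W p fW ℓ := by
  haveI : NeZero p := ⟨hp.out.ne_zero⟩
  have hp2 : p ≠ 2 := by omega
  obtain ⟨c₀, hc₀, hrel⟩ :=
    exists_rat_ratPlusSymbol_eq_legendreTwistMinusSum p hp4 V W ⟨C, hC⟩ hadd hfV hfW hN hm
  by_cases hex : ∃ r : ℚ,
      ∑ u : ZMod p, (legendreSym p (u.val : ℤ) : ℚ) * ratMinusSymbol fV (r + (u.val : ℚ) / p) ≠ 0
  · obtain ⟨hχ1, hχq, _⟩ := jacobiChar_prime_ne_one_isQuadratic_isPrimitive p hp2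
    have hχo := jacobiChar_odd_of_mod_four_eq_three p hp4
    have hτ : gaussSum (jacobiChar p) (ZMod.stdAddChar (N := p)) ^ 2 = -(p : ℂ) := by
      rw [gaussSum_sq hχ1 hχq (ZMod.isPrimitive_stdAddChar p), hχo, ZMod.card]
      ring
    have hpal := V.realPeriodRat_mul_sqrt_of_twist_of_neg (d := -(p : ℚ))
      (neg_lt_zero.mpr (by exact_mod_cast hp.out.pos)) W C hC
    have hsq : Real.sqrt (-((-(p : ℚ) : ℚ) : ℝ)) = Real.sqrt p := by push_cast; rw [neg_neg]
    rw [hsq] at hpal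
    have hu0 : padicValRat p (C.u : ℚ) = 0 :=
      padicValRat_u_eq_zero_of_twist_pm_p p hp2 V W hVred (d := -(p : ℤ)) (Or.inr rfl) C
        (by push_cast; exact hC)
    have hua : ‖((|(C.u : ℚ)| : ℚ) : ℚ_[p])‖ = 1 := by
      have hne : (C.u : ℚ) ≠ 0 := by exact_mod_cast C.u.ne_zero
      have h1 : ‖((C.u : ℚ) : ℚ_[p])‖ = 1 := by
        rw [Padic.eq_padicNorm, padicNorm.eq_zpow_of_nonzero hne, hu0, neg_zero, zpow_zero,
          Rat.cast_one]
      rcases abs_choice (C.u : ℚ) with h | h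
      · rw [h, h1]
      · rw [h, Rat.cast_neg, norm_neg, h1]
    have hcinf : ‖((((W.baseChange ℝ).numRealComponents : ℕ) : ℚ) : ℚ_[p])‖ = 1 := by
      rw [numRealComponents]
      split_ifs
      · haveI : Fact (Nat.Prime 2) := ⟨Nat.prime_two⟩
        have h2 : padicNorm p ((2 : ℕ) : ℚ) = 1 := padicNorm.padicNorm_of_prime_of_ne hp2
        rw [Nat.cast_ofNat] at h2
        rw [Nat.cast_ofNat, Padic.eq_padicNorm, h2, Rat.cast_one]
      · simp
    have hPal' : W.realPeriodRat * Real.sqrt p =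
        ((|(C.u : ℚ)| : ℚ) : ℝ) * ((((W.baseChange ℝ).numRealComponents : ℕ) : ℚ) : ℝ) *
          V.imaginaryPeriodRat := by
      rw [Rat.cast_abs, Rat.cast_natCast]
      exact hpal
    obtain ⟨uW, huW, hΩW⟩ := hperW
    obtain ⟨uV, huV, hΩV⟩ := hperV
    have hunit : ‖(c₀ : ℚ_[p])‖ = 1 :=
      norm_ratCast_eq_one_of_period_relation_odd p hτ (hrel hex) hPal' hΩW hΩV huW huV hua hcinf
        W.realPeriodRat_pos_holds
    exact plusSymbolLevelLowersAt_of_legendreTwistFn W fW (fun x ↦ ratMinusSymbol fV x) c₀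
      (not_dvd_den_of_norm_ratCast_le_one hunit.le) hint hc₀ hμ hℓ hV hw hH
  · simp only [not_exists, not_not] at hex
    refine ⟨0, fun _ _ ↦ rfl, fun q _ r ↦ by simp, fun r ↦ ?_⟩
    rw [hc₀ r, hex r, mul_zero, Rat.cast_zero, Pi.zero_apply, Pi.zero_apply, sub_zero]

end Summit.BirchSwinnertonDyer.Rank1Residual.Additive

end
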